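/-
Copyright (c) 2026 the pub-hodgecm-mathlib formalisation cell (harness21).  Prover seat hodgecm-mathlib-F0P2-p11 (g3): Track B «K2-LIT», squad F0∕P2 re-dealt to L1;
block-D desk K2Liu-p12 (g6) WORDS #8∕#9 «(R-a) WITH THE PIN: the index value of record `val° X := κ⁻¹·τ(σc X)`» (2026-09-05T01:45Z), package of record ★ p864094
`K2LiuIncoherentRankOneBlockDLettersOfRecord`; K1-a♮ witnesses of record ★ p864217 `K2LiuKindOneSingularTailWitnesses`; tie K2E3-typ4 (v19 `val := val°`).
#184♮ = hLiu418 = `stmt-HodgeConjecture-24832`.  THEOREMS ONLY (no `def`, no instance, no notation, no named-fact hypothesis, no `sorry`, default heartbeats).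
-/
import Summits.HodgeConjecture.HodgeConjecture.Theorems.K2LiuIncoherentRankOneSignJunction          -- ★ p863951: `hcorner` shape, `embedding_complexConj_mul_self`, frame vocabulary
import Summits.HodgeConjecture.HodgeConjecture.Theorems.K2LiuKindOneSingularCornerTraceLetter       -- ★ `trace_of_mem_maximalRealSubfield`, `trace_mul_imagUnit_ne_zero`, `gramR_apply_ne_zero`
import Summits.HodgeConjecture.HodgeConjecture.Theorems.K2LiuIncoherentRankOneBadSetInclusions      -- ★ p863950: `finite_setOf_valued_algebraMap_ne_one`
import Summits.HodgeConjecture.HodgeConjecture.Theorems.K2LiuRankOneIndexValue                      -- ★ `imPart_mem` (the `L⁺`-coordinates of `t ∈ L`)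
import Literature.NumberTheory.QuadraticForms.CyclotomicHilbertReciprocity                          -- ★ `hilbertSymbol_mul_norm_left` (norm values do not move `(·, θ)`)
import HarnessLib

/-!
# Crux `HLiu418`, #42S BLOCK D — THE INDEX VALUE OF RECORD `val° X = Tr(σc X·δ_L)∕Tr(α·δ_L) = κ⁻¹·τ(σc X) = val₂ X·N(t_X)` and the transfer of the `val`-letters

Cell `hodgecm-mathlib`, hLiu418 = `stmt-HodgeConjecture-24832`, route `HCCMUnconditional`; lane `--supports stmt-HodgeConjecture-24832 --as helper`.  CLOSES NO SOCKET.
WHY (block-D desk K2Liu-p12 (g6) WORDS #8–#9).  ★ p864094 `hdead_blockD_of_record` is ABSTRACT in the index value `val : M₂(L) → L⁺` (★'s binder, with `hval`); its D-4∕D-5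
letters `hint hPval hD°` are VALUATION statements about `val X` off `T X h`, which the K1-a♮ witnesses of record ★ p864217 export in the CORNER-TRACE currency
`τ(σ) := gramR 1 1·Tr_{L∕L⁺}(σ·δ_L)` ((h4) `v ∈ D S h ↔ |τ(σc S)|_v ≠ 1 ∧ v ∉ T S h`, (h5) `mτ S v = (−log|τ(σc S)|_v).toNat`, (j) `|τ(σc S)|_v ≤ 1` off `T`).  The earlier value `val₂`
(★ p862841) is off by a norm: `σc X = α·val₂ X·N(t_X)` (★ p863170).  The value OF RECORD is the corner read in `L⁺`: any `val` with the PIN `hvalc : σc X = α·↑(val X)` on rank one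
(the closed form `Tr(σc X·δ_L)∕Tr(α·δ_L)` satisfies it, §3); then `τ(σc X) = κ·val X` with the constant `κ = gramR 1 1·Tr(α·δ_L) ≠ 0` (valuations agree off the finite `Base_κ`),
and `val X = val₂ X·N(t_X)` (Hilbert symbols `(·,θ)_v` and signs at complex places agree with `val₂`'s everywhere — the pattern `(S₁, T₁)` read off `hINC` is NOT relabelled).
HEADS (rank `2`, hypothesis-first on `hvalc`): §2 `cornerTrace_eq_kappa_mul_val`, `valued_valOfRecord_eq`, `kappa_ne_zero`, `valued_eq_one_of_not_mem`; §3 `hcorner_of_valOfRecord`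
(★ p863951's `hcorner`, witness `t := 1`), `hval_of_valOfRecord` (from ★ p864217 (g)'s `τ(σc X) ≠ 0`), `valOfRecord_closedForm_spec`; §4 ★ p864094's D-4∕D-5 letters BY NAME:
`hD_offT_of_record` ((h4)), `hint_of_record` ((j)), `hPval_of_record` ((h5) + the witness's polynomial, `cP := 1`); §5 `hilbertSymbol_valOfRecord_eq`, `re_embedding_valOfRecord_neg_iff`.
HONEST LABEL.  CM-field algebra only; the corner `σc`, the witnesses' clauses and ★ p863170's identity enter BY VALUE; `HC_CM` is proved only modulo the 7 printed citations
(2 remaining named inputs: hLiu418 = `stmt-HodgeConjecture-24832`, h413 = `stmt-HodgeConjecture-24833`) until rung 0 closes.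

## References
* [Kudla1997] S. Kudla, *Central derivatives of Eisenstein series and height pairings*, Ann. of Math. 146 (1997): §2.
* [KudlaRallis1994] S. Kudla, S. Rallis, *A regularized Siegel–Weil formula: the first term identity*, Ann. of Math. 140 (1994): §2 (2.10)–(2.12).
* [Omeara1963] O. T. O'Meara, *Introduction to Quadratic Forms* (1963): §63B (63:10).
* [Shimura1997] G. Shimura, *Euler Products and Eisenstein Series*, CBMS 93 (1997): §18.1 (18.4), §18.4.
* [CasselsFrohlichANT1967] J. W. S. Cassels, A. Fröhlich (eds.), *Algebraic Number Theory* (1967): Ch. XV (Tate) §3.1.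
-/

set_option autoImplicit false
set_option linter.dupNamespace false -- the mandated namespace repeats `HodgeConjecture.HodgeConjecture`

noncomputable section

open scoped Matrix
open NumberField NumberField.InfinitePlace IsDedekindDomain
open Literature.NumberTheory.QuadraticForms
open Literature.NumberTheory.Automorphic Literature.NumberTheory.Automorphic.UnitaryGroup Literature.NumberTheory.GaloisRepresentations
open Literature.NumberTheory.GelbartRogawski1991 Literature.NumberTheory.GelbartRogawski1991.GRConstruction
open Literature.NumberTheory.GelbartRogawski1991.UnitaryDualPair

namespace Summit.HodgeConjecture.HodgeConjecture.Cruxes.HLiu418.K2LiuIncoherentRankOneIndexValueOfRecord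

open K2LiuSiegelUnipotentFourierDefs K2LiuKindOneSingularCornerTraceLetter K2LiuIncoherentRankOneSignJunction K2LiuIncoherentRankOneBadSetInclusions
open K2LiuRankOneIndexValue (imPart_mem)

/-! ## §1 CM-field algebra: norms are `p² − θ q²`, norms do not move `(·, θ)_v` or signs, the trace of `α·r·δ_L` -/

section Algebra

variable (L : Type) [Field L] [NumberField L] [IsCMField L]

/-- `c t · t ∈ L⁺` (it is `c`-fixed). [cite: Shimura1997, §18.1] -/
theorem complexConj_mul_self_mem (t : L) : IsCMField.complexConj L t * t ∈ maximalRealSubfield L := by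
  rw [← IsCMField.complexConj_eq_self_iff, map_mul, IsCMField.complexConj_apply_apply, mul_comm]

/-- **A NORM FROM `L = L⁺(√θ)` IS A VALUE `p² − θ q²`** (`θ = α₀²`, `c α₀ = −α₀`; `p = (t + c t)∕2`, `q = (t − c t)∕(2α₀)`). [cite: Omeara1963, §63B] [cite: Shimura1997, §18.1] -/
theorem exists_norm_eq_sq_sub_mul_sq (t : L) :
    ∃ p q : Fp L, (⟨IsCMField.complexConj L t * t, complexConj_mul_self_mem L t⟩ : Fp L) = p ^ 2 - (cmQuadraticGenerator L : Fp L) * q ^ 2 := by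
  obtain ⟨α₀, hα0, hαc, hsq⟩ := cmQuadraticGenerator_spec L
  have hp : (t + IsCMField.complexConj L t) * 2⁻¹ ∈ maximalRealSubfield L := by
    rw [← IsCMField.complexConj_eq_self_iff, map_mul, map_add, IsCMField.complexConj_apply_apply, map_inv₀, map_ofNat, add_comm]
  refine ⟨⟨_, hp⟩, ⟨_, imPart_mem L hαc t⟩, Subtype.ext ?_⟩
  have hθ : ((cmQuadraticGenerator L : Fp L) : L) = α₀ ^ 2 := hsq.symm
  push_cast
  rw [hθ]
  field_simp
  ring

/-- **NORM VALUES DO NOT MOVE THE HILBERT SYMBOL WITH `θ` AT A FINITE PLACE**: `(x · ι_v N(t), θ)_v = (x, θ)_v` for `t ≠ 0` (★ `hilbertSymbol_mul_norm_left`, O'Meara 63:10).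
[cite: Omeara1963, §63B] -/
theorem hilbertSymbol_mul_norm_adicCompletion (v : HeightOneSpectrum (𝓞 (Fp L))) (x : v.adicCompletion (Fp L)) {t : L} (ht : t ≠ 0) :
    hilbertSymbol (v.adicCompletion (Fp L)) (x * algebraMap (Fp L) (v.adicCompletion (Fp L)) ⟨IsCMField.complexConj L t * t, complexConj_mul_self_mem L t⟩)
        (algebraMap (Fp L) (v.adicCompletion (Fp L)) (cmQuadraticGenerator L : Fp L)) =
      hilbertSymbol (v.adicCompletion (Fp L)) x (algebraMap (Fp L) (v.adicCompletion (Fp L)) (cmQuadraticGenerator L : Fp L)) := by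
  haveI : CharZero (v.adicCompletion (Fp L)) := charZero_of_injective_algebraMap (algebraMap (Fp L) (v.adicCompletion (Fp L))).injective
  haveI : NeZero (2 : v.adicCompletion (Fp L)) := ⟨two_ne_zero⟩
  obtain ⟨p, q, hpq⟩ := exists_norm_eq_sq_sub_mul_sq L t
  have hθ0 : (cmQuadraticGenerator L : Fp L) ≠ 0 := fun h => not_isSquare_cmQuadraticGenerator L (h ▸ IsSquare.zero)
  have hN0 : (⟨IsCMField.complexConj L t * t, complexConj_mul_self_mem L t⟩ : Fp L) ≠ 0 := by
    intro h
    have h' : IsCMField.complexConj L t * t = 0 := congrArg Subtype.val h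
    exact ht (by simpa [mul_eq_zero, map_eq_zero] using h')
  have hN : (algebraMap (Fp L) (v.adicCompletion (Fp L)) p) ^ 2 -
      algebraMap (Fp L) (v.adicCompletion (Fp L)) (cmQuadraticGenerator L : Fp L) * (algebraMap (Fp L) (v.adicCompletion (Fp L)) q) ^ 2 ≠ 0 := by
    rw [← map_pow, ← map_pow, ← map_mul, ← map_sub, ← hpq]
    exact (map_ne_zero _).2 hN0
  rw [hpq, map_sub, map_mul, map_pow, map_pow]
  exact hilbertSymbol_mul_norm_left ((map_ne_zero _).2 hθ0) hN x

/-- **NORM VALUES DO NOT MOVE THE SIGN AT A COMPLEX EMBEDDING**: `Re τ(z · c t · t) < 0 ↔ Re τ z < 0` for `t ≠ 0` (`τ(c t · t) = |τ t|² > 0`, ★ `embedding_complexConj_mul_self`).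
[cite: Shimura1997, §18.4] -/
theorem re_embedding_mul_norm_neg_iff (τ : L →+* ℂ) (z : L) {t : L} (ht : t ≠ 0) :
    (τ (z * (IsCMField.complexConj L t * t))).re < 0 ↔ (τ z).re < 0 := by
  have hr : 0 < ‖τ t‖ ^ 2 := pow_pos (norm_pos_iff.2 ((map_ne_zero τ).2 ht)) 2
  rw [map_mul, embedding_complexConj_mul_self τ t, Complex.re_mul_ofReal]
  constructor
  · intro h
    by_contra hz
    exact absurd h (not_lt.2 (mul_nonneg (not_lt.1 hz) hr.le))
  · exact fun h => mul_neg_of_neg_of_pos h hr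

/-- **THE TRACE OF `α·r·δ_L` IS `r` TIMES THE TRACE OF `α·δ_L`** for `r ∈ L⁺` (`Tr_{L∕L⁺}` is `L⁺`-linear). [cite: Shimura1997, §18.1 (18.4)] -/
theorem trace_mul_coe_mul_imagUnit (α : L) (r : Fp L) :
    Algebra.trace (Fp L) L (α * (r : L) * imagUnit L) = Algebra.trace (Fp L) L (α * imagUnit L) * r := by
  have h : α * (r : L) * imagUnit L = r • (α * imagUnit L) := by
    rw [Algebra.smul_def]
    change α * (r : L) * imagUnit L = (r : L) * (α * imagUnit L)
    ring
  rw [h, LinearMap.map_smul, smul_eq_mul, mul_comm]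

/-- **THE CLOSED FORM OF THE VALUE**: for imaginary `σ` and an imaginary unit `α`, `α · (Tr(σ·δ_L) ∕ Tr(α·δ_L)) = σ` (`σ∕α ∈ L⁺`, `Tr` is `L⁺`-linear). [cite: Shimura1997, §18.1 (18.4)] -/
theorem mul_coe_trace_inv_mul_trace {α σ : L} (hα0 : α ≠ 0) (hαc : IsCMField.complexConj L α = -α) (hσ : IsCMField.complexConj L σ = -σ) :
    α * (((Algebra.trace (Fp L) L (α * imagUnit L))⁻¹ * Algebra.trace (Fp L) L (σ * imagUnit L) : Fp L) : L) = σ := by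
  have hr : σ * α⁻¹ ∈ maximalRealSubfield L := by
    rw [← IsCMField.complexConj_eq_self_iff, map_mul, map_inv₀, hσ, hαc, inv_neg, neg_mul_neg]
  have hσr : σ = α * ((⟨σ * α⁻¹, hr⟩ : Fp L) : L) := by
    show σ = α * (σ * α⁻¹)
    field_simp
  have htr : Algebra.trace (Fp L) L (σ * imagUnit L) = Algebra.trace (Fp L) L (α * imagUnit L) * ⟨σ * α⁻¹, hr⟩ := by
    conv_lhs => rw [hσr]
    exact trace_mul_coe_mul_imagUnit L α _
  rw [htr, inv_mul_cancel_left₀ (trace_mul_imagUnit_ne_zero L hα0 hαc)]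
  exact hσr.symm

end Algebra

/-! ## §2 At the rank-`2` frame: `τ(σc X) = κ · val X`, valuations off `Base_κ` -/

section Frame

variable (L : Type) [Field L] [NumberField L] [IsCMField L]

variable {N M : ℕ} (e : Fin N × Fin M ≃ Fin 2)
  (dV : Fin N → L) (hdV : ∀ i, IsCMField.complexConj L (dV i) = dV i)
  (dW : Fin M → L) (hdW : ∀ i, IsCMField.complexConj L (dW i) = dW i)

/-- **`κ ≠ 0`**: `κ := gramR 1 1 · Tr(α·δ_L) ≠ 0` for the imaginary unit `α` (★ `gramR_apply_ne_zero`, ★ `trace_mul_imagUnit_ne_zero`). [cite: Shimura1997, §18.1 (18.4)] -/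
theorem kappa_ne_zero (hdV0 : ∀ i, dV i ≠ 0) (hdW0 : ∀ i, dW i ≠ 0) {α : L} (hα0 : α ≠ 0) (hαc : IsCMField.complexConj L α = -α) :
    gramR L e dV hdV dW hdW 1 1 * Algebra.trace (Fp L) L (α * imagUnit L) ≠ 0 :=
  mul_ne_zero (gramR_apply_ne_zero L e dV hdV hdV0 dW hdW hdW0 1) (trace_mul_imagUnit_ne_zero L hα0 hαc)

omit [IsCMField L] in
/-- **`|κ|_v = 1` OFF ANY BAD SET CONTAINING `Base_κ = {v ∣ |κ|_v ≠ 1}`** (finite, ★ `finite_setOf_valued_algebraMap_ne_one`; the tie enlarges `Tx`). [cite: CasselsFrohlichANT1967, Ch. XV (Tate) §3.1] -/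
theorem valued_eq_one_of_not_mem {I H : Type*} {κ : Fp L} (hκ0 : κ ≠ 0) (T : I → H → Finset (HeightOneSpectrum (𝓞 (Fp L))))
    (hBase : ∀ X h, (finite_setOf_valued_algebraMap_ne_one L hκ0).toFinset ⊆ T X h) :
    ∀ X h (v : HeightOneSpectrum (𝓞 (Fp L))), v ∉ T X h → Valued.v (algebraMap (Fp L) (v.adicCompletion (Fp L)) κ) = 1 := by
  intro X h v hv
  by_contra hne
  exact hv (hBase X h ((Set.Finite.mem_toFinset _).2 hne))

/-- **THE CORNER TRACE IS `κ` TIMES THE VALUE**: under the pin `hvalc : σc X = α·↑(val X)` on rank one, `τ(σc X) = gramR 1 1·Tr(σc X·δ_L) = κ · val X` with `κ = gramR 1 1·Tr(α·δ_L)`.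
[cite: Shimura1997, §18.1 (18.4)] [cite: Kudla1997, §2] -/
theorem cornerTrace_eq_kappa_mul_val
    (val : Matrix (Fin 2) (Fin 2) L → ↥(maximalRealSubfield L))
    (σc : skewMatrices ((IsCMField.complexConj L : L ≃ₐ[Fp L] L) : L →+* L) ((gramR L e dV hdV dW hdW).map (algebraMap (Fp L) L)) → L) {α : L}
    (hvalc : ∀ X : skewMatrices ((IsCMField.complexConj L : L ≃ₐ[Fp L] L) : L →+* L) ((gramR L e dV hdV dW hdW).map (algebraMap (Fp L) L)),
      (X : Matrix (Fin 2) (Fin 2) L) ≠ 0 → (X : Matrix (Fin 2) (Fin 2) L).det = 0 → σc X = α * ((val X : ↥(maximalRealSubfield L)) : L)) :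
    ∀ X : skewMatrices ((IsCMField.complexConj L : L ≃ₐ[Fp L] L) : L →+* L) ((gramR L e dV hdV dW hdW).map (algebraMap (Fp L) L)),
      (X : Matrix (Fin 2) (Fin 2) L) ≠ 0 → (X : Matrix (Fin 2) (Fin 2) L).det = 0 →
        gramR L e dV hdV dW hdW 1 1 * Algebra.trace (Fp L) L (σc X * imagUnit L) = (gramR L e dV hdV dW hdW 1 1 * Algebra.trace (Fp L) L (α * imagUnit L)) * val X := by
  intro X hX0 hdet
  rw [hvalc X hX0 hdet, trace_mul_coe_mul_imagUnit L α (val X), mul_assoc]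

/-- **VALUATIONS OF THE VALUE = VALUATIONS OF THE CORNER TRACE OFF `Base_κ`**: `|val X|_v = |τ(σc X)|_v` at every `v` with `|κ|_v = 1` (rank-one `X`, pin `hvalc`).
[cite: CasselsFrohlichANT1967, Ch. XV (Tate) §3.1] [cite: Kudla1997, §2] -/
theorem valued_valOfRecord_eq
    (val : Matrix (Fin 2) (Fin 2) L → ↥(maximalRealSubfield L))
    (σc : skewMatrices ((IsCMField.complexConj L : L ≃ₐ[Fp L] L) : L →+* L) ((gramR L e dV hdV dW hdW).map (algebraMap (Fp L) L)) → L) {α : L}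
    (hvalc : ∀ X : skewMatrices ((IsCMField.complexConj L : L ≃ₐ[Fp L] L) : L →+* L) ((gramR L e dV hdV dW hdW).map (algebraMap (Fp L) L)),
      (X : Matrix (Fin 2) (Fin 2) L) ≠ 0 → (X : Matrix (Fin 2) (Fin 2) L).det = 0 → σc X = α * ((val X : ↥(maximalRealSubfield L)) : L))
    (X : skewMatrices ((IsCMField.complexConj L : L ≃ₐ[Fp L] L) : L →+* L) ((gramR L e dV hdV dW hdW).map (algebraMap (Fp L) L)))
    (hX0 : (X : Matrix (Fin 2) (Fin 2) L) ≠ 0) (hdet : (X : Matrix (Fin 2) (Fin 2) L).det = 0) (v : HeightOneSpectrum (𝓞 (Fp L)))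
    (hκ : Valued.v (algebraMap (Fp L) (v.adicCompletion (Fp L)) (gramR L e dV hdV dW hdW 1 1 * Algebra.trace (Fp L) L (α * imagUnit L))) = 1) :
    Valued.v (algebraMap ↥(maximalRealSubfield L) (v.adicCompletion ↥(maximalRealSubfield L)) (val X)) =
      Valued.v (algebraMap (Fp L) (v.adicCompletion (Fp L)) (gramR L e dV hdV dW hdW 1 1 * Algebra.trace (Fp L) L (σc X * imagUnit L))) := by
  rw [cornerTrace_eq_kappa_mul_val L e dV hdV dW hdW val σc hvalc X hX0 hdet, map_mul, Valuation.map_mul, hκ, one_mul]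

end Frame

/-! ## §3 The frame letters at the value of record: `hcorner` (witness `t := 1`), `hval`, and the closed form -/

section FrameLetters

variable (L : Type) [Field L] [NumberField L] [IsCMField L]

variable {N M : ℕ} (e : Fin N × Fin M ≃ Fin 2)
  (dV : Fin N → L) (hdV : ∀ i, IsCMField.complexConj L (dV i) = dV i)
  (dW : Fin M → L) (hdW : ∀ i, IsCMField.complexConj L (dW i) = dW i)

/-- **★ p863951's `hcorner` AT THE VALUE OF RECORD, constant witness `t := 1`**: the pin `σc X = α·↑(val X)` IS the corner identity with `c 1 · 1 = 1`.
[cite: Kudla1997, §2] [cite: KudlaRallis1994, §2 (2.10)–(2.12)] -/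
theorem hcorner_of_valOfRecord
    (val : Matrix (Fin 2) (Fin 2) L → ↥(maximalRealSubfield L))
    (σc : skewMatrices ((IsCMField.complexConj L : L ≃ₐ[Fp L] L) : L →+* L) ((gramR L e dV hdV dW hdW).map (algebraMap (Fp L) L)) → L) {α : L}
    (hvalc : ∀ X : skewMatrices ((IsCMField.complexConj L : L ≃ₐ[Fp L] L) : L →+* L) ((gramR L e dV hdV dW hdW).map (algebraMap (Fp L) L)),
      (X : Matrix (Fin 2) (Fin 2) L) ≠ 0 → (X : Matrix (Fin 2) (Fin 2) L).det = 0 → σc X = α * ((val X : ↥(maximalRealSubfield L)) : L)) :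
    ∀ X : skewMatrices ((IsCMField.complexConj L : L ≃ₐ[Fp L] L) : L →+* L) ((gramR L e dV hdV dW hdW).map (algebraMap (Fp L) L)),
      (X : Matrix (Fin 2) (Fin 2) L) ≠ 0 → (X : Matrix (Fin 2) (Fin 2) L).det = 0 →
        ∃ t : L, t ≠ 0 ∧ σc X = α * ((val X : ↥(maximalRealSubfield L)) : L) * (IsCMField.complexConj L t * t) :=
  fun X hX0 hdet => ⟨1, one_ne_zero, by rw [map_one, mul_one, mul_one]; exact hvalc X hX0 hdet⟩

/-- **★'s `hval` AT THE VALUE OF RECORD**: `val X ≠ 0` on rank one, from ★ p864217 (g)'s corner-trace letter `gramR 1 1 · Tr(σc X·δ_L) ≠ 0` (if `val X = 0` then `σc X = 0`).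
[cite: Kudla1997, §2] [cite: Shimura1997, §18.1 (18.4)] -/
theorem hval_of_valOfRecord
    (val : Matrix (Fin 2) (Fin 2) L → ↥(maximalRealSubfield L))
    (σc : skewMatrices ((IsCMField.complexConj L : L ≃ₐ[Fp L] L) : L →+* L) ((gramR L e dV hdV dW hdW).map (algebraMap (Fp L) L)) → L) {α : L}
    (hvalc : ∀ X : skewMatrices ((IsCMField.complexConj L : L ≃ₐ[Fp L] L) : L →+* L) ((gramR L e dV hdV dW hdW).map (algebraMap (Fp L) L)),
      (X : Matrix (Fin 2) (Fin 2) L) ≠ 0 → (X : Matrix (Fin 2) (Fin 2) L).det = 0 → σc X = α * ((val X : ↥(maximalRealSubfield L)) : L))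
    (hτ : ∀ X : skewMatrices ((IsCMField.complexConj L : L ≃ₐ[Fp L] L) : L →+* L) ((gramR L e dV hdV dW hdW).map (algebraMap (Fp L) L)),
      (X : Matrix (Fin 2) (Fin 2) L) ≠ 0 → (X : Matrix (Fin 2) (Fin 2) L).det = 0 →
        gramR L e dV hdV dW hdW 1 1 * Algebra.trace (Fp L) L (σc X * imagUnit L) ≠ 0) :
    ∀ X : skewMatrices ((IsCMField.complexConj L : L ≃ₐ[Fp L] L) : L →+* L) ((gramR L e dV hdV dW hdW).map (algebraMap (Fp L) L)),
      (X : Matrix (Fin 2) (Fin 2) L) ≠ 0 → (X : Matrix (Fin 2) (Fin 2) L).det = 0 → val X ≠ 0 := by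
  intro X hX0 hdet h0
  apply hτ X hX0 hdet
  rw [hvalc X hX0 hdet, h0, ZeroMemClass.coe_zero, mul_zero, zero_mul, map_zero, mul_zero]

/-- **THE CLOSED FORM SATISFIES THE PIN**: with `val° := fun Y => Tr(α·δ_L)⁻¹ · Tr((Function.extend Subtype.val σc 0 Y)·δ_L)` (the corner extended by `0` off the skew matrices),
`σc X = α·↑(val° ↑X)` for every rank-one `X` whose corner is imaginary (`hσ`; `α` an imaginary unit). [cite: Shimura1997, §18.1 (18.4)] [cite: Kudla1997, §2] -/
theorem valOfRecord_closedForm_spec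
    (σc : skewMatrices ((IsCMField.complexConj L : L ≃ₐ[Fp L] L) : L →+* L) ((gramR L e dV hdV dW hdW).map (algebraMap (Fp L) L)) → L)
    {α : L} (hα0 : α ≠ 0) (hαc : IsCMField.complexConj L α = -α)
    (hσ : ∀ X : skewMatrices ((IsCMField.complexConj L : L ≃ₐ[Fp L] L) : L →+* L) ((gramR L e dV hdV dW hdW).map (algebraMap (Fp L) L)),
      (X : Matrix (Fin 2) (Fin 2) L) ≠ 0 → (X : Matrix (Fin 2) (Fin 2) L).det = 0 → IsCMField.complexConj L (σc X) = -σc X) :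
    ∀ X : skewMatrices ((IsCMField.complexConj L : L ≃ₐ[Fp L] L) : L →+* L) ((gramR L e dV hdV dW hdW).map (algebraMap (Fp L) L)),
      (X : Matrix (Fin 2) (Fin 2) L) ≠ 0 → (X : Matrix (Fin 2) (Fin 2) L).det = 0 →
        σc X = α * (((Algebra.trace (Fp L) L (α * imagUnit L))⁻¹ *
          Algebra.trace (Fp L) L (Function.extend (Subtype.val : skewMatrices ((IsCMField.complexConj L : L ≃ₐ[Fp L] L) : L →+* L)
            ((gramR L e dV hdV dW hdW).map (algebraMap (Fp L) L)) → Matrix (Fin 2) (Fin 2) L) σc 0 (X : Matrix (Fin 2) (Fin 2) L) * imagUnit L) : Fp L) : L) := by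
  intro X hX0 hdet
  rw [Subtype.val_injective.extend_apply]
  exact (mul_coe_trace_inv_mul_trace L hα0 hαc (hσ X hX0 hdet)).symm

end FrameLetters

/-! ## §4 ★ p864094's D-4∕D-5 letters at the value of record, from ★ p864217's clauses (h4) (h5) (j) -/

section BlockD

variable (L : Type) [Field L] [NumberField L] [IsCMField L]

variable {N M : ℕ} (e : Fin N × Fin M ≃ Fin 2)
  (dV : Fin N → L) (hdV : ∀ i, IsCMField.complexConj L (dV i) = dV i)
  (dW : Fin M → L) (hdW : ∀ i, IsCMField.complexConj L (dW i) = dW i)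

/-- **D-5's RELAXED `hD°` OF ★ p864094 FROM (h4)** (BY VALUE) and `|κ|_v = 1` off `T X h`: `v ∉ T X h → |val X|_v ≠ 1 → v ∈ D X h`. [cite: CasselsFrohlichANT1967, Ch. XV (Tate) §3.1] [cite: Kudla1997, §2] -/
theorem hD_offT_of_record
    (val : Matrix (Fin 2) (Fin 2) L → ↥(maximalRealSubfield L))
    (σc : skewMatrices ((IsCMField.complexConj L : L ≃ₐ[Fp L] L) : L →+* L) ((gramR L e dV hdV dW hdW).map (algebraMap (Fp L) L)) → L) {α : L}
    (hvalc : ∀ X : skewMatrices ((IsCMField.complexConj L : L ≃ₐ[Fp L] L) : L →+* L) ((gramR L e dV hdV dW hdW).map (algebraMap (Fp L) L)),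
      (X : Matrix (Fin 2) (Fin 2) L) ≠ 0 → (X : Matrix (Fin 2) (Fin 2) L).det = 0 → σc X = α * ((val X : ↥(maximalRealSubfield L)) : L))
    (T D : skewMatrices ((IsCMField.complexConj L : L ≃ₐ[Fp L] L) : L →+* L) ((gramR L e dV hdV dW hdW).map (algebraMap (Fp L) L)) → HA L e dV hdV dW hdW →
      Finset (HeightOneSpectrum (𝓞 (Fp L))))
    (hD4 : ∀ S : skewMatrices ((IsCMField.complexConj L : L ≃ₐ[Fp L] L) : L →+* L) ((gramR L e dV hdV dW hdW).map (algebraMap (Fp L) L)),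
      (S : Matrix (Fin 2) (Fin 2) L) ≠ 0 → (S : Matrix (Fin 2) (Fin 2) L).det = 0 → ∀ (h : HA L e dV hdV dW hdW) (v : HeightOneSpectrum (𝓞 (Fp L))),
        v ∈ D S h ↔ Valued.v (algebraMap (Fp L) (v.adicCompletion (Fp L)) (gramR L e dV hdV dW hdW 1 1 * Algebra.trace (Fp L) L (σc S * imagUnit L))) ≠ 1 ∧ v ∉ T S h)
    (hκT : ∀ (X : skewMatrices ((IsCMField.complexConj L : L ≃ₐ[Fp L] L) : L →+* L) ((gramR L e dV hdV dW hdW).map (algebraMap (Fp L) L))) (h : HA L e dV hdV dW hdW)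
      (v : HeightOneSpectrum (𝓞 (Fp L))), v ∉ T X h →
        Valued.v (algebraMap (Fp L) (v.adicCompletion (Fp L)) (gramR L e dV hdV dW hdW 1 1 * Algebra.trace (Fp L) L (α * imagUnit L))) = 1) :
    ∀ X : skewMatrices ((IsCMField.complexConj L : L ≃ₐ[Fp L] L) : L →+* L) ((gramR L e dV hdV dW hdW).map (algebraMap (Fp L) L)),
      (X : Matrix (Fin 2) (Fin 2) L) ≠ 0 → (X : Matrix (Fin 2) (Fin 2) L).det = 0 → ∀ h : HA L e dV hdV dW hdW, ∀ v, v ∉ T X h →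
      Valued.v (algebraMap ↥(maximalRealSubfield L) (v.adicCompletion ↥(maximalRealSubfield L)) (val X)) ≠ 1 → v ∈ D X h := by
  intro X hX0 hdet h v hvT hne
  rw [valued_valOfRecord_eq L e dV hdV dW hdW val σc hvalc X hX0 hdet v (hκT X h v hvT)] at hne
  exact (hD4 X hX0 hdet h v).2 ⟨hne, hvT⟩

/-- **D-4's `hint` OF ★ p864094 FROM (j)'s valuation conjunct** (BY VALUE) and `|κ|_v = 1` off `T X h`: `v ∈ D X h → v ∉ T X h → |val X|_v ≤ 1`. [cite: CasselsFrohlichANT1967, Ch. XV (Tate) §3.1] -/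
theorem hint_of_record
    (val : Matrix (Fin 2) (Fin 2) L → ↥(maximalRealSubfield L))
    (σc : skewMatrices ((IsCMField.complexConj L : L ≃ₐ[Fp L] L) : L →+* L) ((gramR L e dV hdV dW hdW).map (algebraMap (Fp L) L)) → L) {α : L}
    (hvalc : ∀ X : skewMatrices ((IsCMField.complexConj L : L ≃ₐ[Fp L] L) : L →+* L) ((gramR L e dV hdV dW hdW).map (algebraMap (Fp L) L)),
      (X : Matrix (Fin 2) (Fin 2) L) ≠ 0 → (X : Matrix (Fin 2) (Fin 2) L).det = 0 → σc X = α * ((val X : ↥(maximalRealSubfield L)) : L))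
    (T D : skewMatrices ((IsCMField.complexConj L : L ≃ₐ[Fp L] L) : L →+* L) ((gramR L e dV hdV dW hdW).map (algebraMap (Fp L) L)) → HA L e dV hdV dW hdW →
      Finset (HeightOneSpectrum (𝓞 (Fp L))))
    (hj : ∀ (S : skewMatrices ((IsCMField.complexConj L : L ≃ₐ[Fp L] L) : L →+* L) ((gramR L e dV hdV dW hdW).map (algebraMap (Fp L) L))) (h : HA L e dV hdV dW hdW)
      (v : HeightOneSpectrum (𝓞 (Fp L))), v ∉ T S h →
        Valued.v (algebraMap (Fp L) (v.adicCompletion (Fp L)) (gramR L e dV hdV dW hdW 1 1 * Algebra.trace (Fp L) L (σc S * imagUnit L))) ≤ 1)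
    (hκT : ∀ (X : skewMatrices ((IsCMField.complexConj L : L ≃ₐ[Fp L] L) : L →+* L) ((gramR L e dV hdV dW hdW).map (algebraMap (Fp L) L))) (h : HA L e dV hdV dW hdW)
      (v : HeightOneSpectrum (𝓞 (Fp L))), v ∉ T X h →
        Valued.v (algebraMap (Fp L) (v.adicCompletion (Fp L)) (gramR L e dV hdV dW hdW 1 1 * Algebra.trace (Fp L) L (α * imagUnit L))) = 1) :
    ∀ X : skewMatrices ((IsCMField.complexConj L : L ≃ₐ[Fp L] L) : L →+* L) ((gramR L e dV hdV dW hdW).map (algebraMap (Fp L) L)),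
      (X : Matrix (Fin 2) (Fin 2) L) ≠ 0 → (X : Matrix (Fin 2) (Fin 2) L).det = 0 → ∀ h : HA L e dV hdV dW hdW, ∀ v ∈ D X h, v ∉ T X h →
      Valued.v (algebraMap ↥(maximalRealSubfield L) (v.adicCompletion ↥(maximalRealSubfield L)) (val X)) ≤ 1 := by
  intro X hX0 hdet h v _ hvT
  rw [valued_valOfRecord_eq L e dV hdV dW hdW val σc hvalc X hX0 hdet v (hκT X h v hvT)]
  exact hj X h v hvT

/-- **D-4's `hPval` OF ★ p864094 FROM (h5) AT `cP := 1`**: the witness's shell polynomial `P X h v s = Σ_{k ≤ mτ X v} (ε_v q_v^{1−2s})^k` (`hPdef`, `rfl` at the tie) and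
(h5) `mτ X v = (−log|τ(σc X)|_v).toNat` BY VALUE, `|κ|_v = 1` off `T X h` ⟹ the centre polynomial has degree `ord_v(val X)`. [cite: Kudla1997, §2] [cite: KudlaRallis1994, §2 (2.10)–(2.12)] -/
theorem hPval_of_record
    (val : Matrix (Fin 2) (Fin 2) L → ↥(maximalRealSubfield L))
    (σc : skewMatrices ((IsCMField.complexConj L : L ≃ₐ[Fp L] L) : L →+* L) ((gramR L e dV hdV dW hdW).map (algebraMap (Fp L) L)) → L) {α : L}
    (hvalc : ∀ X : skewMatrices ((IsCMField.complexConj L : L ≃ₐ[Fp L] L) : L →+* L) ((gramR L e dV hdV dW hdW).map (algebraMap (Fp L) L)),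
      (X : Matrix (Fin 2) (Fin 2) L) ≠ 0 → (X : Matrix (Fin 2) (Fin 2) L).det = 0 → σc X = α * ((val X : ↥(maximalRealSubfield L)) : L))
    (T D : skewMatrices ((IsCMField.complexConj L : L ≃ₐ[Fp L] L) : L →+* L) ((gramR L e dV hdV dW hdW).map (algebraMap (Fp L) L)) → HA L e dV hdV dW hdW →
      Finset (HeightOneSpectrum (𝓞 (Fp L))))
    (mτ : skewMatrices ((IsCMField.complexConj L : L ≃ₐ[Fp L] L) : L →+* L) ((gramR L e dV hdV dW hdW).map (algebraMap (Fp L) L)) → HeightOneSpectrum (𝓞 (Fp L)) → ℕ)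
    (P : skewMatrices ((IsCMField.complexConj L : L ≃ₐ[Fp L] L) : L →+* L) ((gramR L e dV hdV dW hdW).map (algebraMap (Fp L) L)) → HA L e dV hdV dW hdW →
      HeightOneSpectrum (𝓞 ↥(maximalRealSubfield L)) → ℂ → ℂ)
    (hPdef : ∀ (X : skewMatrices ((IsCMField.complexConj L : L ≃ₐ[Fp L] L) : L →+* L) ((gramR L e dV hdV dW hdW).map (algebraMap (Fp L) L))) (h : HA L e dV hdV dW hdW)
      (v : HeightOneSpectrum (𝓞 (Fp L))) (s : ℂ),
        P X h v s = ∑ k ∈ Finset.range (mτ X v + 1), ((quadraticHeckeCharCM L).valueAtUniformizer v * (v.residueCard : ℂ) ^ (1 - 2 * s)) ^ k)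
    (hm5 : ∀ (S : skewMatrices ((IsCMField.complexConj L : L ≃ₐ[Fp L] L) : L →+* L) ((gramR L e dV hdV dW hdW).map (algebraMap (Fp L) L))) (v : HeightOneSpectrum (𝓞 (Fp L))),
      mτ S v = (-WithZero.log (Valued.v (algebraMap (Fp L) (v.adicCompletion (Fp L)) (gramR L e dV hdV dW hdW 1 1 * Algebra.trace (Fp L) L (σc S * imagUnit L))))).toNat)
    (hκT : ∀ (X : skewMatrices ((IsCMField.complexConj L : L ≃ₐ[Fp L] L) : L →+* L) ((gramR L e dV hdV dW hdW).map (algebraMap (Fp L) L))) (h : HA L e dV hdV dW hdW)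
      (v : HeightOneSpectrum (𝓞 (Fp L))), v ∉ T X h →
        Valued.v (algebraMap (Fp L) (v.adicCompletion (Fp L)) (gramR L e dV hdV dW hdW 1 1 * Algebra.trace (Fp L) L (α * imagUnit L))) = 1) :
    ∀ X : skewMatrices ((IsCMField.complexConj L : L ≃ₐ[Fp L] L) : L →+* L) ((gramR L e dV hdV dW hdW).map (algebraMap (Fp L) L)),
      (X : Matrix (Fin 2) (Fin 2) L) ≠ 0 → (X : Matrix (Fin 2) (Fin 2) L).det = 0 → ∀ h : HA L e dV hdV dW hdW, ∀ v ∈ D X h, v ∉ T X h →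
      P X h v (1 / 2) = 1 *
        ∑ k ∈ Finset.range ((-WithZero.log (Valued.v (algebraMap ↥(maximalRealSubfield L) (v.adicCompletion ↥(maximalRealSubfield L)) (val X)))).toNat + 1),
          ((quadraticHeckeCharCM L).valueAtUniformizer v * ((v.residueCard : ℕ) : ℂ) ^ (1 - 2 * (1 / 2 : ℂ))) ^ k := by
  intro X hX0 hdet h v _ hvT
  rw [one_mul, hPdef, hm5 X v, valued_valOfRecord_eq L e dV hdV dW hdW val σc hvalc X hX0 hdet v (hκT X h v hvT)]

end BlockD

/-! ## §5 Transfer to the `val₂` currency: Hilbert symbols and signs do not move -/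

section Transfer

variable (L : Type) [Field L] [NumberField L] [IsCMField L]

variable {N M : ℕ} (e : Fin N × Fin M ≃ Fin 2)
  (dV : Fin N → L) (hdV : ∀ i, IsCMField.complexConj L (dV i) = dV i)
  (dW : Fin M → L) (hdW : ∀ i, IsCMField.complexConj L (dW i) = dW i)

/-- **THE VALUE OF RECORD IS `val₂ · N(t_X)`**: the pin and ★ p863170's `σc X = α·val₂ X·(c t·t)` give `↑(val X) = ↑(val₂ X)·(c t·t)`. [cite: Kudla1997, §2] [cite: Shimura1997, §18.4] -/
theorem coe_valOfRecord_eq_mul_norm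
    (val val₂ : Matrix (Fin 2) (Fin 2) L → ↥(maximalRealSubfield L))
    (σc : skewMatrices ((IsCMField.complexConj L : L ≃ₐ[Fp L] L) : L →+* L) ((gramR L e dV hdV dW hdW).map (algebraMap (Fp L) L)) → L) {α : L} (hα0 : α ≠ 0)
    (hvalc : ∀ X : skewMatrices ((IsCMField.complexConj L : L ≃ₐ[Fp L] L) : L →+* L) ((gramR L e dV hdV dW hdW).map (algebraMap (Fp L) L)),
      (X : Matrix (Fin 2) (Fin 2) L) ≠ 0 → (X : Matrix (Fin 2) (Fin 2) L).det = 0 → σc X = α * ((val X : ↥(maximalRealSubfield L)) : L))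
    (X : skewMatrices ((IsCMField.complexConj L : L ≃ₐ[Fp L] L) : L →+* L) ((gramR L e dV hdV dW hdW).map (algebraMap (Fp L) L)))
    (hX0 : (X : Matrix (Fin 2) (Fin 2) L) ≠ 0) (hdet : (X : Matrix (Fin 2) (Fin 2) L).det = 0) {t : L}
    (ht : σc X = α * ((val₂ X : ↥(maximalRealSubfield L)) : L) * (IsCMField.complexConj L t * t)) :
    ((val X : ↥(maximalRealSubfield L)) : L) = ((val₂ X : ↥(maximalRealSubfield L)) : L) * (IsCMField.complexConj L t * t) :=
  mul_left_cancel₀ hα0 (by rw [← mul_assoc, ← ht]; exact (hvalc X hX0 hdet).symm)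

/-- **HILBERT SYMBOLS DO NOT MOVE** (transfer for the D-2 ∕ `hgood` letters): under the pin and ★ p863170's `hcorner₂`, `(val X, θ)_v = (val₂ X, θ)_v` at every finite `v`
(norms are `(·,θ)_v`-trivial) — the pattern's `S₁` reads identically in both currencies. [cite: Omeara1963, §63B] [cite: Kudla1997, §2] -/
theorem hilbertSymbol_valOfRecord_eq
    (val val₂ : Matrix (Fin 2) (Fin 2) L → ↥(maximalRealSubfield L))
    (σc : skewMatrices ((IsCMField.complexConj L : L ≃ₐ[Fp L] L) : L →+* L) ((gramR L e dV hdV dW hdW).map (algebraMap (Fp L) L)) → L) {α : L} (hα0 : α ≠ 0)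
    (hvalc : ∀ X : skewMatrices ((IsCMField.complexConj L : L ≃ₐ[Fp L] L) : L →+* L) ((gramR L e dV hdV dW hdW).map (algebraMap (Fp L) L)),
      (X : Matrix (Fin 2) (Fin 2) L) ≠ 0 → (X : Matrix (Fin 2) (Fin 2) L).det = 0 → σc X = α * ((val X : ↥(maximalRealSubfield L)) : L))
    (hcorner₂ : ∀ X : skewMatrices ((IsCMField.complexConj L : L ≃ₐ[Fp L] L) : L →+* L) ((gramR L e dV hdV dW hdW).map (algebraMap (Fp L) L)),
      (X : Matrix (Fin 2) (Fin 2) L) ≠ 0 → (X : Matrix (Fin 2) (Fin 2) L).det = 0 →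
        ∃ t : L, t ≠ 0 ∧ σc X = α * ((val₂ X : ↥(maximalRealSubfield L)) : L) * (IsCMField.complexConj L t * t)) :
    ∀ X : skewMatrices ((IsCMField.complexConj L : L ≃ₐ[Fp L] L) : L →+* L) ((gramR L e dV hdV dW hdW).map (algebraMap (Fp L) L)),
      (X : Matrix (Fin 2) (Fin 2) L) ≠ 0 → (X : Matrix (Fin 2) (Fin 2) L).det = 0 → ∀ v : HeightOneSpectrum (𝓞 ↥(maximalRealSubfield L)),
      hilbertSymbol (v.adicCompletion ↥(maximalRealSubfield L)) (algebraMap ↥(maximalRealSubfield L) _ (val X))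
          (algebraMap ↥(maximalRealSubfield L) _ (cmQuadraticGenerator L : ↥(maximalRealSubfield L))) =
        hilbertSymbol (v.adicCompletion ↥(maximalRealSubfield L)) (algebraMap ↥(maximalRealSubfield L) _ (val₂ X))
          (algebraMap ↥(maximalRealSubfield L) _ (cmQuadraticGenerator L : ↥(maximalRealSubfield L))) := by
  intro X hX0 hdet v
  obtain ⟨t, ht, hc⟩ := hcorner₂ X hX0 hdet
  have hvv : val X = val₂ X * ⟨IsCMField.complexConj L t * t, complexConj_mul_self_mem L t⟩ :=
    Subtype.ext (coe_valOfRecord_eq_mul_norm L e dV hdV dW hdW val val₂ σc hα0 hvalc X hX0 hdet hc)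
  rw [hvv, map_mul]
  exact hilbertSymbol_mul_norm_adicCompletion L v _ ht

/-- **SIGNS DO NOT MOVE** (transfer for the D-3 letters): `Re σ_w(val X) < 0 ↔ Re σ_w(val₂ X) < 0` at every `w` (`σ_w(c t·t) = |σ_w t|² > 0`). [cite: Kudla1997, §2] [cite: Shimura1997, §18.4] -/
theorem re_embedding_valOfRecord_neg_iff
    (val val₂ : Matrix (Fin 2) (Fin 2) L → ↥(maximalRealSubfield L))
    (σc : skewMatrices ((IsCMField.complexConj L : L ≃ₐ[Fp L] L) : L →+* L) ((gramR L e dV hdV dW hdW).map (algebraMap (Fp L) L)) → L) {α : L} (hα0 : α ≠ 0)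
    (hvalc : ∀ X : skewMatrices ((IsCMField.complexConj L : L ≃ₐ[Fp L] L) : L →+* L) ((gramR L e dV hdV dW hdW).map (algebraMap (Fp L) L)),
      (X : Matrix (Fin 2) (Fin 2) L) ≠ 0 → (X : Matrix (Fin 2) (Fin 2) L).det = 0 → σc X = α * ((val X : ↥(maximalRealSubfield L)) : L))
    (hcorner₂ : ∀ X : skewMatrices ((IsCMField.complexConj L : L ≃ₐ[Fp L] L) : L →+* L) ((gramR L e dV hdV dW hdW).map (algebraMap (Fp L) L)),
      (X : Matrix (Fin 2) (Fin 2) L) ≠ 0 → (X : Matrix (Fin 2) (Fin 2) L).det = 0 →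
        ∃ t : L, t ≠ 0 ∧ σc X = α * ((val₂ X : ↥(maximalRealSubfield L)) : L) * (IsCMField.complexConj L t * t)) :
    ∀ X : skewMatrices ((IsCMField.complexConj L : L ≃ₐ[Fp L] L) : L →+* L) ((gramR L e dV hdV dW hdW).map (algebraMap (Fp L) L)),
      (X : Matrix (Fin 2) (Fin 2) L) ≠ 0 → (X : Matrix (Fin 2) (Fin 2) L).det = 0 → ∀ w : InfinitePlace L,
      (w.embedding (algebraMap ↥(maximalRealSubfield L) L (val X))).re < 0 ↔ (w.embedding (algebraMap ↥(maximalRealSubfield L) L (val₂ X))).re < 0 := by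
  intro X hX0 hdet w
  obtain ⟨t, ht, hc⟩ := hcorner₂ X hX0 hdet
  have hvv : algebraMap ↥(maximalRealSubfield L) L (val X) = algebraMap ↥(maximalRealSubfield L) L (val₂ X) * (IsCMField.complexConj L t * t) :=
    coe_valOfRecord_eq_mul_norm L e dV hdV dW hdW val val₂ σc hα0 hvalc X hX0 hdet hc
  rw [hvv]
  exact re_embedding_mul_norm_neg_iff L w.embedding _ ht

end Transfer

end Summit.HodgeConjecture.HodgeConjecture.Cruxes.HLiu418.K2LiuIncoherentRankOneIndexValueOfRecord

end
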